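import Literature.AnabelianGeometry.EtaleTheta.ThetaCoversKummerTwistGroup
import Literature.AnabelianGeometry.EtaleTheta.ThetaCoversHeisenbergWitness

/-!
# The Kummer-twisted Heisenberg toy `(ℤ/l)³ ⋊ D_l`: the subgroups `Π_X`, `Δ̄_Θ`, `D_x`, `Π_X̲`, `Π_C̲`, the
# inversion `ι = s r`, and the toy facts behind the [EtTh] §2 interface axioms

Mochizuki, *The Étale Theta Function …* [EtTh], Publ. RIMS 45 (2009), §2, Def 2.1 – Prop 2.2 (pp.35–38),
Cor 2.9 (p.43) (bib key `MochizukiEtTh2009`).  PURE FINITE GROUP THEORY over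
`ThetaCoversKummerTwistGroup.lean` (no claim about print): in `kumPiC l = (ℤ/l)³ ⋊ D_l` (coordinates
`x, y, z`; `D_l = ⟨r, s⟩`) we single out

* `kumPiX` — the `D_l`-component is a rotation (index `2`);  `kumZ = {(0, y, 0)} ⋊ 1` — the centre
  (`Δ̄_Θ`-part, CENTRAL in all of `kumPiC`: `z_central`);  `kumDx = {(0, y, z)} ⋊ 1` — the cusp group
  `D_x = ⟨c, g⟩`, which maps ONTO the Galois coordinate `z` and is NOT normal;  `kumH = (ℤ/l)³ ⋊ 1`
  (`Π_X̲`-part) and `kumHp = (ℤ/l)³ ⋊ {1, s r}` (`Π_C̲`-part), with the inversion `ι := s r` (NOT `s`: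
  `s r` is the reflection normalising `D_x`);
* the toy facts: `Δ_X := kumPiX ∩ Ker(z)` has exponent `l` (`pow_eq_one`), abelianisation coordinates
  `(x, rotation index)` with kernel `kumZ` (`ellCoords`), a reflection with `z = 0` inverts `Δ_X` modulo
  `kumZ` (`inv_ell`), the rotation character `kumPiX ↠ ℤ/l` with kernel `kumH` (`rotChar`), `[kumHp : kumH] = 2`,
  and the `(∓1)`-eigen-behaviour of `ι` (`iota_minus`).

Consumer: the tempered model `ThetaCoversKummerTwistTemperedDefs.lean` (abc-iut cell, seat abc-iut-f-141,
FACT-LIST row F-0601). [folklore]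
-/

namespace Literature.AnabelianGeometry.EtaleTheta

namespace ThetaCovers

namespace KummerWitness

open Multiplicative HeisenbergWitness

variable (l : ℕ)

/-! ## 1. `Π_X`: rotations -/

/-- **`Π_X` of the toy**: the elements whose `D_l`-component is a rotation. (toy bookkeeping; no claim about
print) [cite: MochizukiEtTh2009, Def 2.1 p.36] -/
def kumPiX : Subgroup (kumPiC l) := ((sgn l).comp SemidirectProduct.rightHom).ker

/-- Membership in `Π_X`. (toy bookkeeping; no claim about print) [cite: MochizukiEtTh2009, Def 2.1 p.36] -/
theorem mem_kumPiX {g : kumPiC l} : g ∈ kumPiX l ↔ ∃ i, g.right = DihedralGroup.r i := by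
  rw [kumPiX, MonoidHom.mem_ker, MonoidHom.comp_apply, SemidirectProduct.rightHom_eq_right]
  exact sgn_eq_one_iff l g.right

/-- A reflection is not in `Π_X`. (toy bookkeeping; no claim about print) [cite: MochizukiEtTh2009, Def 2.1 p.36] -/
theorem not_mem_kumPiX_of_sr {g : kumPiC l} {j : ZMod l} (hg : g.right = DihedralGroup.sr j) : g ∉ kumPiX l := by
  intro h
  obtain ⟨i, hi⟩ := (mem_kumPiX l).mp h
  rw [hg] at hi
  cases hi

/-- An element outside `Π_X` is a reflection. (toy bookkeeping; no claim about print) [cite: MochizukiEtTh2009, Def 2.1 p.36] -/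
theorem exists_sr_of_not_mem {g : kumPiC l} (hg : g ∉ kumPiX l) : ∃ j, g.right = DihedralGroup.sr j := by
  rcases h : g.right with j | j
  · exact absurd ((mem_kumPiX l).mpr ⟨j, h⟩) hg
  · exact ⟨j, rfl⟩

/-- `[Π_C : Π_X] = 2`. (toy bookkeeping; no claim about print) [cite: MochizukiEtTh2009, Def 2.1 p.36] -/
theorem index_kumPiX : (kumPiX l).index = 2 := by
  have hsurj : Function.Surjective ((sgn l).comp (SemidirectProduct.rightHom (φ := theta l))) := by
    intro y
    obtain ⟨a, rfl⟩ := Multiplicative.ofAdd.surjective y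
    fin_cases a
    · exact ⟨SemidirectProduct.inr (DihedralGroup.r 0), rfl⟩
    · exact ⟨SemidirectProduct.inr (DihedralGroup.sr 0), rfl⟩
  rw [kumPiX, Subgroup.index_ker, MonoidHom.range_eq_top.mpr hsurj, Subgroup.card_top,
    Nat.card_eq_fintype_card, Fintype.card_multiplicative, ZMod.card]

/-- `Π_X` is normal. (toy bookkeeping; no claim about print) [cite: MochizukiEtTh2009, Def 2.1 p.36] -/
theorem kumPiX_normal : (kumPiX l).Normal := MonoidHom.normal_ker _

/-! ## 2. The centre `Δ̄_Θ`-part, the cusp group `D_x`, `Π_X̲`, `Π_C̲` -/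

/-- **`Δ̄_Θ`-part of the toy** (the centre): `{(0, y, 0)} ⋊ 1`. (toy bookkeeping; no claim about print)
[cite: MochizukiEtTh2009, Def 2.1 p.36] -/
def kumZ : Subgroup (kumPiC l) where
  carrier := {g | g.right = 1 ∧ ξ l g = 0 ∧ ζ l g = 0}
  mul_mem' := by
    rintro a b ⟨ha1, ha2, ha3⟩ ⟨hb1, hb2, hb3⟩
    exact ⟨by simp [ha1, hb1], by simp [ha1, ha2, hb2, hb3], by simp [ha3, hb3]⟩
  one_mem' := ⟨rfl, ξ_one l, ζ_one l⟩
  inv_mem' := by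
    rintro a ⟨ha1, ha2, ha3⟩
    exact ⟨by simp [ha1], by simp [ha1, ha2, ha3], by simp [ha3]⟩

/-- Membership in `Δ̄_Θ`-part. (toy bookkeeping; no claim about print) [cite: MochizukiEtTh2009, Def 2.1 p.36] -/
theorem mem_kumZ {g : kumPiC l} : g ∈ kumZ l ↔ g.right = 1 ∧ ξ l g = 0 ∧ ζ l g = 0 := Iff.rfl

/-- **`D_x` of the toy**: `{(0, y, z)} ⋊ 1` = `⟨c, g⟩`. (toy bookkeeping; no claim about print)
[cite: MochizukiEtTh2009, Def 2.1 p.36] -/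
def kumDx : Subgroup (kumPiC l) where
  carrier := {g | g.right = 1 ∧ ξ l g = 0}
  mul_mem' := by
    rintro a b ⟨ha1, ha2⟩ ⟨hb1, hb2⟩
    exact ⟨by simp [ha1, hb1], by simp [ha1, ha2, hb2]⟩
  one_mem' := ⟨rfl, ξ_one l⟩
  inv_mem' := by
    rintro a ⟨ha1, ha2⟩
    exact ⟨by simp [ha1], by simp [ha1, ha2]⟩

/-- Membership in `D_x`. (toy bookkeeping; no claim about print) [cite: MochizukiEtTh2009, Def 2.1 p.36] -/
theorem mem_kumDx {g : kumPiC l} : g ∈ kumDx l ↔ g.right = 1 ∧ ξ l g = 0 := Iff.rfl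

/-- **`Π_X̲`-part of the toy**: `(ℤ/l)³ ⋊ 1`. (toy bookkeeping; no claim about print) [cite: MochizukiEtTh2009, Def 2.1 p.36] -/
def kumH : Subgroup (kumPiC l) where
  carrier := {g | g.right = 1}
  mul_mem' := by
    rintro a b ha hb
    simp only [Set.mem_setOf_eq] at ha hb ⊢
    rw [SemidirectProduct.mul_right, ha, hb, one_mul]
  one_mem' := rfl
  inv_mem' := by
    rintro a ha
    simp only [Set.mem_setOf_eq] at ha ⊢
    rw [SemidirectProduct.inv_right, ha, inv_one]

/-- Membership in `Π_X̲`-part. (toy bookkeeping; no claim about print) [cite: MochizukiEtTh2009, Def 2.1 p.36] -/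
theorem mem_kumH {g : kumPiC l} : g ∈ kumH l ↔ g.right = 1 := Iff.rfl

/-- **`Π_C̲`-part of the toy**: `(ℤ/l)³ ⋊ {1, s r}`. (toy bookkeeping; no claim about print) [cite: MochizukiEtTh2009, Def 2.1 p.36] -/
def kumHp : Subgroup (kumPiC l) where
  carrier := {g | g.right = 1 ∨ g.right = DihedralGroup.sr 1}
  mul_mem' := by
    rintro a b (ha | ha) (hb | hb) <;>
      simp only [Set.mem_setOf_eq, SemidirectProduct.mul_right, ha, hb, one_mul, mul_one,
        DihedralGroup.sr_mul_sr, sub_self, DihedralGroup.r_zero, true_or, or_true]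
  one_mem' := Or.inl rfl
  inv_mem' := by
    rintro a (ha | ha)
    · exact Or.inl (by simp [ha])
    · exact Or.inr (by simp [ha])

/-- Membership in `Π_C̲`-part. (toy bookkeeping; no claim about print) [cite: MochizukiEtTh2009, Def 2.1 p.36] -/
theorem mem_kumHp {g : kumPiC l} : g ∈ kumHp l ↔ g.right = 1 ∨ g.right = DihedralGroup.sr 1 := Iff.rfl

/-- `Δ̄_Θ ⊆ D_x`. (toy bookkeeping; no claim about print) [cite: MochizukiEtTh2009, Def 2.1 p.36] -/
theorem kumZ_le_kumDx : kumZ l ≤ kumDx l := fun _ h => ⟨h.1, h.2.1⟩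

/-- `D_x ⊆ Π_X̲`. (toy bookkeeping; no claim about print) [cite: MochizukiEtTh2009, Def 2.1 p.36] -/
theorem kumDx_le_kumH : kumDx l ≤ kumH l := fun _ h => h.1

/-- `Π_X̲ ⊆ Π_X`. (toy bookkeeping; no claim about print) [cite: MochizukiEtTh2009, Def 2.1 p.36] -/
theorem kumH_le_kumPiX : kumH l ≤ kumPiX l := fun g h =>
  (mem_kumPiX l).mpr ⟨0, by rw [(mem_kumH l).mp h, DihedralGroup.one_def]⟩

/-- `Π_X̲ ⊆ Π_C̲`. (toy bookkeeping; no claim about print) [cite: MochizukiEtTh2009, Def 2.1 p.36] -/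
theorem kumH_le_kumHp : kumH l ≤ kumHp l := fun _ h => Or.inl h

/-- `Δ̄_Θ ⊆ Π_X`. (toy bookkeeping; no claim about print) [cite: MochizukiEtTh2009, Def 2.1 p.36] -/
theorem kumZ_le_kumPiX : kumZ l ≤ kumPiX l :=
  ((kumZ_le_kumDx l).trans (kumDx_le_kumH l)).trans (kumH_le_kumPiX l)

/-- `Π_C̲ ∩ Π_X = Π_X̲`. (toy bookkeeping; no claim about print) [cite: MochizukiEtTh2009, Def 2.1 p.36] -/
theorem mem_kumHp_inf {g : kumPiC l} : g ∈ kumHp l ⊓ kumPiX l ↔ g.right = 1 := by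
  rw [Subgroup.mem_inf, mem_kumPiX]
  constructor
  · rintro ⟨h | h, ⟨i, hi⟩⟩
    · exact h
    · rw [h] at hi; cases hi
  · intro h
    exact ⟨Or.inl h, ⟨0, by rw [h, DihedralGroup.one_def]⟩⟩

/-- `Π_C̲ ∩ Π_X = Π_X̲` as subgroups. (toy bookkeeping; no claim about print) [cite: MochizukiEtTh2009, Def 2.1 p.36] -/
theorem kumHp_inf_kumPiX : kumHp l ⊓ kumPiX l = kumH l := by
  ext g
  exact mem_kumHp_inf l

/-- `Δ̄_Θ ⊆ Ker(z)`. (toy bookkeeping; no claim about print) [cite: MochizukiEtTh2009, Def 2.1 p.36] -/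
theorem kumZ_le_ker_aug : kumZ l ≤ (aug l).ker := fun _ h => (mem_ker_aug l).mpr h.2.2

/-- `D_x ∩ Ker(z) = Δ̄_Θ` ("the inertia group `I_x = D_x ∩ Δ_X` maps isomorphically onto `Δ̄_Θ`", here on the
nose). (toy bookkeeping; no claim about print) [cite: MochizukiEtTh2009, Def 2.1 p.36] -/
theorem kumDx_inf_ker_aug : kumDx l ⊓ (aug l).ker = kumZ l := by
  ext g
  rw [Subgroup.mem_inf, mem_kumDx, mem_ker_aug, mem_kumZ]
  tauto

/-- `z` restricted to `D_x` is onto `ℤ/l` (the cusp is "`K`-rational": `D_x ↠ G_K`). (toy bookkeeping; no claim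
about print) [cite: MochizukiEtTh2009, Def 2.1 p.36] -/
theorem aug_kumDx_surjective : Function.Surjective ((aug l).restrict (kumDx l)) := fun t =>
  ⟨⟨mk l 0 0 (toAdd t) 1, rfl, rfl⟩, by simp [MonoidHom.restrict_apply]⟩

/-! ## 3. The centre is central; reflections invert `Δ_X`; `Δ_X` has exponent `l` -/

/-- An element of `Δ̄_Θ`-part is `c^y = (0, y, 0) ⋊ 1`. (toy bookkeeping; no claim about print) [cite: MochizukiEtTh2009, Def 2.1 p.36] -/
theorem eq_mk_of_mem_kumZ {t : kumPiC l} (ht : t ∈ kumZ l) : t = mk l 0 (υ l t) 0 1 :=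
  ext_of_coords l (by simpa using ht.1) (by simpa using ht.2.1) (by simp) (by simpa using ht.2.2)

/-- `c^y` commutes with everything (the action fixes `(0, y, 0)` and `(ℤ/l)³` is abelian). (toy bookkeeping; no
claim about print) [cite: MochizukiEtTh2009, Def 2.1 p.36] -/
theorem mk_y_comm (y : ZMod l) (c : kumPiC l) : c * mk l 0 y 0 1 = mk l 0 y 0 1 * c := by
  refine ext_of_coords l ?_ ?_ ?_ ?_
  · simp [mk]
  · simp
  · simp; ring
  · simp

/-- **`Δ̄_Θ`-part is CENTRAL in `Π_C`**: `c t c⁻¹ t⁻¹ = 1` for `t ∈ kumZ` and ANY `c` (so `K ⊇ μ_l` holds in the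
models, and `Δ̄_Θ` is central in `Δ̄_X`). (toy bookkeeping; no claim about print) [cite: MochizukiEtTh2009, Rmk 2.6.1 p.40] -/
theorem z_central (c : kumPiC l) {t : kumPiC l} (ht : t ∈ kumZ l) : c * t * c⁻¹ * t⁻¹ = 1 := by
  have h : c * t = t * c := by rw [eq_mk_of_mem_kumZ l ht]; exact mk_y_comm l _ c
  rw [h, mul_inv_cancel_right, mul_inv_cancel]

/-- `Δ̄_Θ`-part is normal. (toy bookkeeping; no claim about print) [cite: MochizukiEtTh2009, Def 2.1 p.36] -/
theorem kumZ_normal : (kumZ l).Normal := by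
  refine ⟨fun t ht c => ?_⟩
  have h : c * t * c⁻¹ = t := by
    have := z_central l c ht
    rw [mul_inv_eq_one] at this
    exact this
  rw [h]
  exact ht

/-- **Reflections invert `Δ_X` modulo `Δ̄_Θ`**: for `c ∉ Π_X` with `z(c) = 0` and `d ∈ Π_X` with `z(d) = 0`,
`c d c⁻¹ d ∈ kumZ`. (toy bookkeeping; no claim about print) [cite: MochizukiEtTh2009, Rmk 2.1.1 p.36] -/
theorem inv_ell {c d : kumPiC l} (hc : c ∉ kumPiX l) (hzc : ζ l c = 0) (hd : d ∈ kumPiX l) (hzd : ζ l d = 0) :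
    c * d * c⁻¹ * d ∈ kumZ l := by
  obtain ⟨j, hj⟩ := exists_sr_of_not_mem l hc
  obtain ⟨i, hi⟩ := (mem_kumPiX l).mp hd
  refine (mem_kumZ l).mpr ⟨?_, ?_, ?_⟩
  · rw [SemidirectProduct.mul_right, SemidirectProduct.mul_right, SemidirectProduct.mul_right,
      SemidirectProduct.inv_right, hi, hj, DihedralGroup.inv_sr, DihedralGroup.sr_mul_r,
      DihedralGroup.sr_mul_sr, DihedralGroup.r_mul_r, DihedralGroup.one_def]
    exact congrArg DihedralGroup.r (by ring)
  · simp [hi, hj, hzc, hzd]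
  · simp [hzc, hzd]

/-- Powers in `Δ_X`: coordinates of `d^k` for `d` with rotation component `r^a` and `z(d) = 0`.
(toy bookkeeping; no claim about print) [cite: MochizukiEtTh2009, Def 2.1 p.36] -/
theorem coords_pow {d : kumPiC l} {a : ZMod l} (hd : d.right = DihedralGroup.r a) (hz : ζ l d = 0) (k : ℕ) :
    (d ^ k).right = DihedralGroup.r (a * (k : ZMod l)) ∧ ξ l (d ^ k) = (k : ZMod l) * ξ l d ∧ ζ l (d ^ k) = 0 ∧
      υ l (d ^ k) = (k : ZMod l) * υ l d + a * ξ l d * ((k : ZMod l) * ((k : ZMod l) - 1)) := by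
  induction k with
  | zero =>
    refine ⟨?_, by simp, by simp, by simp⟩
    rw [pow_zero, Nat.cast_zero, mul_zero]
    rfl
  | succ k ih =>
    obtain ⟨h1, h2, h3, h4⟩ := ih
    refine ⟨?_, ?_, ?_, ?_⟩
    · rw [pow_succ, SemidirectProduct.mul_right, h1, hd, DihedralGroup.r_mul_r, Nat.cast_succ, mul_add, mul_one]
    · rw [pow_succ, ξ_mul, h1, h2, hz, eps_r, Nat.cast_succ]; ring
    · rw [pow_succ, ζ_mul, h3, hz, add_zero]
    · rw [pow_succ, υ_mul, h1, h4, hz, rotIdx_r, Nat.cast_succ]; ring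

/-- **`Δ_X` has exponent `l`**: `d^l = 1` for `d ∈ Π_X` with `z(d) = 0` (no parity hypothesis: the doubled
`c`-coordinate makes `y(d^k) = k y + a x k(k−1)` polynomial). (toy bookkeeping; no claim about print)
[cite: MochizukiEtTh2009, Def 2.1 p.36] -/
theorem pow_eq_one {d : kumPiC l} (hd : d ∈ kumPiX l) (hz : ζ l d = 0) : d ^ l = 1 := by
  obtain ⟨a, ha⟩ := (mem_kumPiX l).mp hd
  obtain ⟨h1, h2, h3, h4⟩ := coords_pow l ha hz l
  refine eq_one_of_coords l ?_ ?_ ?_ h3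
  · rw [h1, DihedralGroup.one_def, ZMod.natCast_self, mul_zero]
  · rw [h2, ZMod.natCast_self, zero_mul]
  · rw [h4, ZMod.natCast_self]; ring

/-! ## 4. The abelianisation coordinates of `Δ_X` and the rotation character of `Π_X` -/

/-- Membership in `Δ_X = Π_X ∩ Ker(z)`: a rotation with `z = 0`. (toy bookkeeping; no claim about print)
[cite: MochizukiEtTh2009, Def 2.1 p.36] -/
theorem mem_delta_iff {g : kumPiC l} : g ∈ kumPiX l ⊓ (aug l).ker ↔ (∃ i, g.right = DihedralGroup.r i) ∧ ζ l g = 0 := by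
  rw [Subgroup.mem_inf, mem_kumPiX, mem_ker_aug]

/-- The coordinates `(x, a)` on `Δ_X = Π_X ∩ Ker(z)` (a homomorphism to `(ℤ/l)²`, kernel `Δ̄_Θ`-part) — the
typed "`Δ̄^ell_X` is a free `(ℤ/lℤ)`-module of rank `2`". (toy bookkeeping; no claim about print)
[cite: MochizukiEtTh2009, Def 2.1 p.36] -/
def ellCoords : ↥(kumPiX l ⊓ (aug l).ker) →* Multiplicative (ZMod l × ZMod l) where
  toFun g := ofAdd (ξ l g.1, rotIdx l g.1.right)
  map_one' := by
    apply toAdd.injective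
    simp only [OneMemClass.coe_one, ξ_one, SemidirectProduct.one_right, rotIdx_one, toAdd_ofAdd, toAdd_one]
    rfl
  map_mul' g h := by
    obtain ⟨⟨i, hi⟩, hzg⟩ := (mem_delta_iff l).mp g.2
    obtain ⟨⟨j, hj⟩, hzh⟩ := (mem_delta_iff l).mp h.2
    apply toAdd.injective
    simp [hi, hj, hzh, toAdd_mul]

/-- `ellCoords` is surjective. (toy bookkeeping; no claim about print) [cite: MochizukiEtTh2009, Def 2.1 p.36] -/
theorem ellCoords_surjective : Function.Surjective (ellCoords l) := by
  intro y
  obtain ⟨⟨b, a⟩, rfl⟩ := Multiplicative.ofAdd.surjective y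
  refine ⟨⟨mk l b 0 0 (DihedralGroup.r a), (mem_delta_iff l).mpr ⟨⟨a, rfl⟩, rfl⟩⟩, ?_⟩
  apply toAdd.injective
  simp only [ellCoords, MonoidHom.coe_mk, OneHom.coe_mk, toAdd_ofAdd, mk_right, rotIdx_r, ξ_mk]

/-- `Ker(ellCoords) = Δ̄_Θ`-part. (toy bookkeeping; no claim about print) [cite: MochizukiEtTh2009, Def 2.1 p.36] -/
theorem ellCoords_ker : (ellCoords l).ker = (kumZ l).subgroupOf _ := by
  ext g
  obtain ⟨⟨i, hi⟩, hz⟩ := (mem_delta_iff l).mp g.2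
  rw [MonoidHom.mem_ker, Subgroup.mem_subgroupOf, mem_kumZ]
  constructor
  · intro h
    have h' := congrArg toAdd h
    simp only [ellCoords, MonoidHom.coe_mk, OneHom.coe_mk, toAdd_ofAdd, toAdd_one, hi, rotIdx_r,
      Prod.mk_eq_zero] at h'
    refine ⟨?_, h'.1, hz⟩
    rw [hi, h'.2]
    rfl
  · rintro ⟨h1, h2, -⟩
    rw [hi, DihedralGroup.one_def, DihedralGroup.r.injEq] at h1
    apply toAdd.injective
    simp only [ellCoords, MonoidHom.coe_mk, OneHom.coe_mk, toAdd_ofAdd, toAdd_one, hi, rotIdx_r, h1, h2]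
    rfl

/-- The rotation-index character `Π_X ↠ ℤ/l`, `(n, r^a) ↦ a` (its kernel is `Π_X̲`-part `kumH`): the quotient `Q`
of Def 2.1 in the toy. (toy bookkeeping; no claim about print) [cite: MochizukiEtTh2009, Def 2.1 p.36] -/
def rotChar : ↥(kumPiX l) →* Multiplicative (ZMod l) where
  toFun g := ofAdd (rotIdx l g.1.right)
  map_one' := by simp
  map_mul' g h := by
    obtain ⟨i, hi⟩ := (mem_kumPiX l).mp g.2
    obtain ⟨j, hj⟩ := (mem_kumPiX l).mp h.2
    apply toAdd.injective
    simp [hi, hj, toAdd_mul]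

/-- `rotChar` is onto. (toy bookkeeping; no claim about print) [cite: MochizukiEtTh2009, Def 2.1 p.36] -/
theorem rotChar_surjective : Function.Surjective (rotChar l) := by
  intro y
  obtain ⟨a, rfl⟩ := Multiplicative.ofAdd.surjective y
  exact ⟨⟨SemidirectProduct.inr (DihedralGroup.r a), (mem_kumPiX l).mpr ⟨a, rfl⟩⟩, rfl⟩

/-- `rotChar g = 1 ↔ g ∈ Π_X̲`-part. (toy bookkeeping; no claim about print) [cite: MochizukiEtTh2009, Def 2.1 p.36] -/
theorem rotChar_eq_one_iff (g : kumPiX l) : rotChar l g = 1 ↔ (g : kumPiC l) ∈ kumH l := by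
  obtain ⟨i, hi⟩ := (mem_kumPiX l).mp g.2
  rw [mem_kumH, hi, DihedralGroup.one_def, DihedralGroup.r.injEq]
  constructor
  · intro h
    have := congrArg toAdd h
    simpa [rotChar, hi] using this
  · intro h
    apply toAdd.injective
    simp [rotChar, hi, h]

/-- `[Π_C̲-part : Π_X̲-part] = 2` (the inversion `s r` represents the non-trivial coset). (toy bookkeeping; no
claim about print) [cite: MochizukiEtTh2009, Def 2.1 p.36] -/
theorem relIndex_kumH : (kumHp l ⊓ kumPiX l).relIndex (kumHp l) = 2 := by
  rw [Subgroup.relIndex_eq_two_iff]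
  refine ⟨SemidirectProduct.inr (DihedralGroup.sr 1), Or.inr rfl, fun b hb => ?_⟩
  rcases hb with hb | hb
  · refine Or.inr ⟨(mem_kumHp_inf l).mpr hb, fun h => ?_⟩
    have h' := (mem_kumHp_inf l).mp h
    rw [SemidirectProduct.mul_right, hb, one_mul, SemidirectProduct.right_inr] at h'
    cases h'
  · refine Or.inl ⟨(mem_kumHp_inf l).mpr ?_, fun h => ?_⟩
    · rw [SemidirectProduct.mul_right, hb, SemidirectProduct.right_inr, DihedralGroup.sr_mul_sr, sub_self,
        DihedralGroup.one_def]
    · have h' := (mem_kumHp_inf l).mp h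
      rw [hb] at h'
      cases h'

/-! ## 5. The inversion `ι := s r` -/

/-- **The inversion of the toy**: `ι := s r ∈ Π_C̲-part ∖ Π_X` (it is `s r`, not `s`, that normalises `D_x`).
(toy bookkeeping; no claim about print) [cite: MochizukiEtTh2009, Prop 2.2 p.36] -/
def iota : kumPiC l := SemidirectProduct.inr (DihedralGroup.sr 1)

/-- `ι.right = s r`. (toy bookkeeping; no claim about print) [cite: MochizukiEtTh2009, Prop 2.2 p.36] -/
@[simp] theorem iota_right : (iota l).right = DihedralGroup.sr 1 := rfl

/-- `ι ∈ Π_C̲`-part. (toy bookkeeping; no claim about print) [cite: MochizukiEtTh2009, Prop 2.2 p.36] -/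
theorem iota_mem_kumHp : iota l ∈ kumHp l := Or.inr rfl

/-- `ι ∉ Π_X`. (toy bookkeeping; no claim about print) [cite: MochizukiEtTh2009, Prop 2.2 p.36] -/
theorem iota_not_mem_kumPiX : iota l ∉ kumPiX l := not_mem_kumPiX_of_sr l rfl

/-- `z(ι) = 0` (`ι ∈ Δ_C`). (toy bookkeeping; no claim about print) [cite: MochizukiEtTh2009, Prop 2.2 p.36] -/
@[simp] theorem ζ_iota : ζ l (iota l) = 0 := ζ_inr l _

/-- `x(ι) = 0`. (toy bookkeeping; no claim about print) [cite: MochizukiEtTh2009, Prop 2.2 p.36] -/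
@[simp] theorem ξ_iota : ξ l (iota l) = 0 := ξ_inr l _

/-- `y(ι) = 0`. (toy bookkeeping; no claim about print) [cite: MochizukiEtTh2009, Prop 2.2 p.36] -/
@[simp] theorem υ_iota : υ l (iota l) = 0 := υ_inr l _

/-- `ι² = 1`. (toy bookkeeping; no claim about print) [cite: MochizukiEtTh2009, Prop 2.2 (iii) p.37] -/
theorem iota_mul_self : iota l * iota l = 1 := by
  rw [iota, ← map_mul, DihedralGroup.sr_mul_sr, sub_self, ← DihedralGroup.one_def, map_one]

/-- `ι` acts by `−1` on `Π_X̲-part ∩ Ker(z)` modulo the centre: `ι e ι⁻¹ e ∈ kumZ`. (toy bookkeeping; no claim about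
print) [cite: MochizukiEtTh2009, Prop 2.2 (i) p.37] -/
theorem iota_minus {e : kumPiC l} (he : e.right = 1) (hz : ζ l e = 0) : iota l * e * (iota l)⁻¹ * e ∈ kumZ l :=
  (mem_kumZ l).mpr ⟨by simp [he], by simp [he, hz], by simp [hz]⟩

/-- Conjugation by `ι` preserves `Π_X̲-part`. (toy bookkeeping; no claim about print) [cite: MochizukiEtTh2009, Prop 2.2 (i) p.37] -/
theorem iota_conj_right {e : kumPiC l} (he : e.right = 1) : (iota l * e * (iota l)⁻¹).right = 1 := by
  simp [he]

/-! ## 6. The Def 2.3 data of the toy: `E` (the `(−1)`-eigenline `y = −x` of `ι = s r`), the splitting `S = ⟨g⟩`,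
`Π_X̲̲`-part `{y = −x} ⋊ 1` and `Π_C̲̲`-part `{y = −x} ⋊ {1, s r}` -/

/-- **`E` of the toy**: the `(−1)`-eigenline of `ι = s r` in the plane `z = 0`: `{(x, −x, 0)} ⋊ 1`. (toy bookkeeping; no
claim about print) [cite: MochizukiEtTh2009, Prop 2.2 (i) p.37] -/
def kumE : Subgroup (kumPiC l) where
  carrier := {g | g.right = 1 ∧ ζ l g = 0 ∧ ξ l g + υ l g = 0}
  mul_mem' := by
    rintro a b ⟨ha1, ha2, ha3⟩ ⟨hb1, hb2, hb3⟩
    refine ⟨by simp [ha1, hb1], by simp [ha2, hb2], ?_⟩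
    simp only [ξ_mul, υ_mul, ha1, eps_one, one_mul, aPar_one, zero_mul, add_zero, rotIdx_one, mul_zero, qPar_one]
    linear_combination ha3 + hb3
  one_mem' := ⟨rfl, ζ_one l, by simp⟩
  inv_mem' := by
    rintro a ⟨ha1, ha2, ha3⟩
    refine ⟨by simp [ha1], by simp [ha2], ?_⟩
    simp only [ξ_inv, υ_inv, ha1, inv_one, eps_one, one_mul, aPar_one, zero_mul, sub_zero, rotIdx_one, mul_zero,
      qPar_one]
    linear_combination -ha3

/-- Membership in `E`. (toy bookkeeping; no claim about print) [cite: MochizukiEtTh2009, Prop 2.2 (i) p.37] -/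
theorem mem_kumE {g : kumPiC l} : g ∈ kumE l ↔ g.right = 1 ∧ ζ l g = 0 ∧ ξ l g + υ l g = 0 := Iff.rfl

/-- **The splitting `S = ⟨g⟩` of the toy**: `{(0, 0, z)} ⋊ 1` (a splitting of `D_x ↠ G_K`). (toy bookkeeping; no claim about
print) [cite: MochizukiEtTh2009, Prop 2.2 (ii) p.37] -/
def kumS : Subgroup (kumPiC l) where
  carrier := {g | g.right = 1 ∧ ξ l g = 0 ∧ υ l g = 0}
  mul_mem' := by
    rintro a b ⟨ha1, ha2, ha3⟩ ⟨hb1, hb2, hb3⟩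
    exact ⟨by simp [ha1, hb1], by simp [ha1, ha2, hb2], by simp [ha1, ha3, hb2, hb3]⟩
  one_mem' := ⟨rfl, ξ_one l, υ_one l⟩
  inv_mem' := by
    rintro a ⟨ha1, ha2, ha3⟩
    exact ⟨by simp [ha1], by simp [ha1, ha2], by simp [ha1, ha2, ha3]⟩

/-- Membership in `S`. (toy bookkeeping; no claim about print) [cite: MochizukiEtTh2009, Prop 2.2 (ii) p.37] -/
theorem mem_kumS {g : kumPiC l} : g ∈ kumS l ↔ g.right = 1 ∧ ξ l g = 0 ∧ υ l g = 0 := Iff.rfl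

/-- **`Π_X̲̲`-part of the toy**: `S · E = {(x, −x, z)} ⋊ 1`. (toy bookkeeping; no claim about print)
[cite: MochizukiEtTh2009, Def 2.3 p.38] -/
def kumXuu : Subgroup (kumPiC l) where
  carrier := {g | g.right = 1 ∧ ξ l g + υ l g = 0}
  mul_mem' := by
    rintro a b ⟨ha1, ha3⟩ ⟨hb1, hb3⟩
    refine ⟨by simp [ha1, hb1], ?_⟩
    simp only [ξ_mul, υ_mul, ha1, eps_one, one_mul, aPar_one, zero_mul, add_zero, rotIdx_one, mul_zero, qPar_one]
    linear_combination ha3 + hb3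
  one_mem' := ⟨rfl, by simp⟩
  inv_mem' := by
    rintro a ⟨ha1, ha3⟩
    refine ⟨by simp [ha1], ?_⟩
    simp only [ξ_inv, υ_inv, ha1, inv_one, eps_one, one_mul, aPar_one, zero_mul, sub_zero, rotIdx_one, mul_zero,
      qPar_one]
    linear_combination -ha3

/-- Membership in `Π_X̲̲`-part. (toy bookkeeping; no claim about print) [cite: MochizukiEtTh2009, Def 2.3 p.38] -/
theorem mem_kumXuu {g : kumPiC l} : g ∈ kumXuu l ↔ g.right = 1 ∧ ξ l g + υ l g = 0 := Iff.rfl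

/-- **`Π_C̲̲`-part of the toy**: `{(x, −x, z)} ⋊ {1, s r}` (`s r` acts on `(x, y, z)` by `(−x, y + 2x, z)`, preserving `y = −x`).
(toy bookkeeping; no claim about print) [cite: MochizukiEtTh2009, Def 2.3 p.38] -/
def kumCuu : Subgroup (kumPiC l) where
  carrier := {g | (g.right = 1 ∨ g.right = DihedralGroup.sr 1) ∧ ξ l g + υ l g = 0}
  mul_mem' := by
    rintro a b ⟨ha1 | ha1, ha3⟩ ⟨hb1 | hb1, hb3⟩
    · refine ⟨Or.inl (by simp [ha1, hb1]), ?_⟩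
      simp only [ξ_mul, υ_mul, ha1, eps_one, one_mul, aPar_one, zero_mul, add_zero, rotIdx_one, mul_zero, qPar_one]
      linear_combination ha3 + hb3
    · refine ⟨Or.inr (by simp [ha1, hb1]), ?_⟩
      simp only [ξ_mul, υ_mul, ha1, eps_one, one_mul, aPar_one, zero_mul, add_zero, rotIdx_one, mul_zero, qPar_one]
      linear_combination ha3 + hb3
    · refine ⟨Or.inr (by simp [ha1, hb1]), ?_⟩
      simp only [ξ_mul, υ_mul, ha1, eps_sr, aPar_sr, rotIdx_sr, qPar, sub_self, zero_mul, mul_zero, add_zero, neg_zero]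
      linear_combination ha3 + hb3
    · refine ⟨Or.inl ?_, ?_⟩
      · rw [SemidirectProduct.mul_right, ha1, hb1, DihedralGroup.sr_mul_sr, sub_self, DihedralGroup.one_def]
      · simp only [ξ_mul, υ_mul, ha1, eps_sr, aPar_sr, rotIdx_sr, qPar, sub_self, zero_mul, mul_zero, add_zero, neg_zero]
        linear_combination ha3 + hb3
  one_mem' := ⟨Or.inl rfl, by simp⟩
  inv_mem' := by
    rintro a ⟨ha1 | ha1, ha3⟩
    · refine ⟨Or.inl (by simp [ha1]), ?_⟩
      simp only [ξ_inv, υ_inv, ha1, inv_one, eps_one, one_mul, aPar_one, zero_mul, sub_zero, rotIdx_one, mul_zero,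
        qPar_one]
      linear_combination -ha3
    · refine ⟨Or.inr (by simp [ha1]), ?_⟩
      simp only [ξ_inv, υ_inv, ha1, DihedralGroup.inv_sr, eps_sr, aPar_sr, rotIdx_sr, qPar, sub_self, zero_mul,
        mul_zero, sub_zero, neg_zero]
      linear_combination -ha3


/-- Membership in `Π_C̲̲`-part. (toy bookkeeping; no claim about print) [cite: MochizukiEtTh2009, Def 2.3 p.38] -/
theorem mem_kumCuu {g : kumPiC l} :
    g ∈ kumCuu l ↔ (g.right = 1 ∨ g.right = DihedralGroup.sr 1) ∧ ξ l g + υ l g = 0 := Iff.rfl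

/-- `S ⊆ D_x`. (toy bookkeeping; no claim about print) [cite: MochizukiEtTh2009, Prop 2.2 (ii) p.37] -/
theorem kumS_le_kumDx : kumS l ≤ kumDx l := fun _ h => ⟨h.1, h.2.1⟩

/-- `S ∩ Δ̄_Θ = 1`. (toy bookkeeping; no claim about print) [cite: MochizukiEtTh2009, Prop 2.2 (ii) p.37] -/
theorem kumS_inf_kumZ : kumS l ⊓ kumZ l = ⊥ := by
  rw [eq_bot_iff]
  rintro g ⟨⟨h1, h2, h3⟩, -, -, h4⟩
  exact eq_one_of_coords l h1 h2 h3 h4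

/-- `E ∩ Δ̄_Θ = 1`. (toy bookkeeping; no claim about print) [cite: MochizukiEtTh2009, Prop 2.2 (i) p.37] -/
theorem kumE_inf_kumZ : kumE l ⊓ kumZ l = ⊥ := by
  rw [eq_bot_iff]
  rintro g ⟨⟨h1, h2, h3⟩, -, h4, -⟩
  rw [h4, zero_add] at h3
  exact eq_one_of_coords l h1 h4 h3 h2

/-- `E ⊆ Π_X̲-part ∩ Ker(z)`. (toy bookkeeping; no claim about print) [cite: MochizukiEtTh2009, Prop 2.2 (i) p.37] -/
theorem kumE_le : kumE l ≤ kumH l ⊓ (aug l).ker := fun _ h => ⟨h.1, (mem_ker_aug l).mpr h.2.1⟩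

/-- `E · Δ̄_Θ = Π_X̲-part ∩ Ker(z)` (the plane `z = 0`: `(x, y, 0) = (x, −x, 0)·(0, x + y, 0)`). (toy bookkeeping; no claim about
print) [cite: MochizukiEtTh2009, Prop 2.2 (i) p.37] -/
theorem kumE_sup_kumZ : kumE l ⊔ kumZ l = kumH l ⊓ (aug l).ker := by
  refine le_antisymm (sup_le (kumE_le l) (le_inf ((kumZ_le_kumDx l).trans (kumDx_le_kumH l)) (kumZ_le_ker_aug l)))
    fun g hg => ?_
  have h1 : g.right = 1 := (Subgroup.mem_inf.mp hg).1
  have h2 : ζ l g = 0 := (mem_ker_aug l).mp (Subgroup.mem_inf.mp hg).2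
  have hg' : g = mk l (ξ l g) (-ξ l g) 0 1 * mk l 0 (ξ l g + υ l g) 0 1 :=
    ext_of_coords l (by simp [h1, mk]) (by simp) (by simp) (by simp [h2])
  rw [hg']
  exact Subgroup.mul_mem _ (Subgroup.mem_sup_left ⟨rfl, rfl, by simp⟩) (Subgroup.mem_sup_right ⟨rfl, rfl, rfl⟩)

/-- `S · E = Π_X̲̲`-part. (toy bookkeeping; no claim about print) [cite: MochizukiEtTh2009, Def 2.3 p.38] -/
theorem kumS_sup_kumE : kumS l ⊔ kumE l = kumXuu l := by
  refine le_antisymm (sup_le (fun _ h => ⟨h.1, by rw [h.2.1, h.2.2, add_zero]⟩) (fun _ h => ⟨h.1, h.2.2⟩)) fun g hg => ?_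
  obtain ⟨h1, h2⟩ := hg
  have hg' : g = mk l 0 0 (ζ l g) 1 * mk l (ξ l g) (υ l g) 0 1 :=
    ext_of_coords l (by simp [h1, mk]) (by simp) (by simp) (by simp)
  rw [hg']
  exact Subgroup.mul_mem _ (Subgroup.mem_sup_left ⟨rfl, rfl, rfl⟩) (Subgroup.mem_sup_right ⟨rfl, rfl, by simpa using h2⟩)

/-- `Π_X̲̲-part · Δ̄_Θ = Π_X̲-part`. (toy bookkeeping; no claim about print) [cite: MochizukiEtTh2009, Def 2.3 p.38] -/
theorem kumXuu_sup_kumZ : kumXuu l ⊔ kumZ l = kumH l := by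
  refine le_antisymm (sup_le (fun _ h => h.1) ((kumZ_le_kumDx l).trans (kumDx_le_kumH l))) fun g hg => ?_
  rw [mem_kumH] at hg
  have hg' : g = mk l (ξ l g) (-ξ l g) (ζ l g) 1 * mk l 0 (ξ l g + υ l g) 0 1 :=
    ext_of_coords l (by simp [hg, mk]) (by simp) (by simp) (by simp)
  rw [hg']
  exact Subgroup.mul_mem _ (Subgroup.mem_sup_left ⟨rfl, by simp⟩) (Subgroup.mem_sup_right ⟨rfl, rfl, rfl⟩)

/-- `Π_C̲̲-part ∩ Π_X = Π_X̲̲-part`. (toy bookkeeping; no claim about print) [cite: MochizukiEtTh2009, Def 2.3 p.38] -/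
theorem kumCuu_inf_kumPiX : kumCuu l ⊓ kumPiX l = kumXuu l := by
  ext g
  rw [Subgroup.mem_inf, mem_kumCuu, mem_kumPiX, mem_kumXuu]
  constructor
  · rintro ⟨⟨h1 | h1, h2⟩, ⟨i, hi⟩⟩
    · exact ⟨h1, h2⟩
    · rw [h1] at hi; cases hi
  · rintro ⟨h1, h2⟩
    exact ⟨⟨Or.inl h1, h2⟩, ⟨0, by rw [h1, DihedralGroup.one_def]⟩⟩

/-- `Π_X̲̲-part ⊆ Π_C̲̲-part`. (toy bookkeeping; no claim about print) [cite: MochizukiEtTh2009, Def 2.3 p.38] -/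
theorem kumXuu_le_kumCuu : kumXuu l ≤ kumCuu l := fun _ h => ⟨Or.inl h.1, h.2⟩

/-- `ι ∈ Π_C̲̲-part`. (toy bookkeeping; no claim about print) [cite: MochizukiEtTh2009, Def 2.3 p.38] -/
theorem iota_mem_kumCuu : iota l ∈ kumCuu l := ⟨Or.inr rfl, by simp⟩

/-- `Π_C̲̲-part ⊆ Π_C̲-part`. (toy bookkeeping; no claim about print) [cite: MochizukiEtTh2009, Def 2.3 p.38] -/
theorem kumCuu_le_kumHp : kumCuu l ≤ kumHp l := fun _ h => h.1

/-- An element of `Π_C̲̲-part` with `D_l`-part `s r` is `x · ι` with `x ∈ Π_X̲̲-part`. (toy bookkeeping; no claim about print)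
[cite: MochizukiEtTh2009, Def 2.3 p.38] -/
theorem mul_iota_inv_mem_kumXuu {g : kumPiC l} (hg : g ∈ kumCuu l) (hr : g.right = DihedralGroup.sr 1) :
    g * (iota l)⁻¹ ∈ kumXuu l := by
  refine ⟨?_, ?_⟩
  · rw [SemidirectProduct.mul_right, SemidirectProduct.inv_right, hr, iota_right, DihedralGroup.inv_sr,
      DihedralGroup.sr_mul_sr, sub_self, DihedralGroup.one_def]
  · have h2 := hg.2
    simp only [ξ_mul, υ_mul, hr, eps_sr, aPar_sr, sub_self, add_zero, rotIdx_sr, ξ_inv, υ_inv, iota_right,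
      ξ_iota, υ_iota, ζ_inv, ζ_iota, mul_zero, neg_zero]
    linear_combination h2

/-- An element of `Π_C̲-part` with `D_l`-part `s r` is `x · ι` with `x ∈ Π_X̲-part`. (toy bookkeeping; no claim about print)
[cite: MochizukiEtTh2009, Def 2.1 p.36] -/
theorem mul_iota_inv_mem_kumH {g : kumPiC l} (hr : g.right = DihedralGroup.sr 1) : g * (iota l)⁻¹ ∈ kumH l := by
  rw [mem_kumH, SemidirectProduct.mul_right, SemidirectProduct.inv_right, hr, iota_right, DihedralGroup.inv_sr,
    DihedralGroup.sr_mul_sr, sub_self, DihedralGroup.one_def]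

/-- `Π_X̲-part · Δ_X = Π_X` (`(w, r^i) = (w, 1)·(0, r^i)`). (toy bookkeeping; no claim about print) [cite: MochizukiEtTh2009, Def 2.1 p.36] -/
theorem kumH_sup_delta : kumH l ⊔ (kumPiX l ⊓ (aug l).ker) = kumPiX l := by
  refine le_antisymm (sup_le (kumH_le_kumPiX l) inf_le_left) fun g hg => ?_
  obtain ⟨i, hi⟩ := (mem_kumPiX l).mp hg
  have hg' : g = mk l (ξ l g) (υ l g) (ζ l g) 1 * SemidirectProduct.inr (DihedralGroup.r i) :=
    ext_of_coords l (by simp [hi, mk]) (by simp) (by simp) (by simp)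
  rw [hg']
  exact Subgroup.mul_mem _ (Subgroup.mem_sup_left (show (mk l _ _ _ 1).right = 1 from rfl))
    (Subgroup.mem_sup_right ⟨(mem_kumPiX l).mpr ⟨i, rfl⟩, (mem_ker_aug l).mpr (ζ_inr l _)⟩)

/-! ## 7. Conjugation facts: `Π_X̲-part` is abelian, `ι` inverts `E`, the normaliser of `D_x` is `Π_C̲-part`,
commutators of `Δ_X` fill the centre -/

/-- `Π_X̲-part = (ℤ/l)³ ⋊ 1` is abelian: `g e g⁻¹ = e` for `g, e` with trivial `D_l`-part. (toy bookkeeping; no claim about print)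
[cite: MochizukiEtTh2009, Prop 2.2 (i) p.37] -/
theorem conj_eq_of_right_eq_one {g e : kumPiC l} (hg : g.right = 1) (he : e.right = 1) : g * e * g⁻¹ = e :=
  ext_of_coords l (by simp [hg, he]) (by simp [hg, he]) (by simp [hg, he]) (by simp)

/-- `ι` acts by `−1` on `E` on the nose: `ι e ι⁻¹ e = 1`. (toy bookkeeping; no claim about print) [cite: MochizukiEtTh2009, Prop 2.2 (i) p.37] -/
theorem iota_conj_mul_self {e : kumPiC l} (he : e ∈ kumE l) : iota l * e * (iota l)⁻¹ * e = 1 := by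
  obtain ⟨h1, h2, h3⟩ := he
  refine eq_one_of_coords l (by simp [h1]) (by simp [h1, h2]) ?_ (by simp [h2])
  have e : υ l (iota l * e * (iota l)⁻¹ * e) = 2 * (ξ l e + υ l e) := by
    simp [h1, h2, qPar]
    ring
  rw [e, h3, mul_zero]

/-- `ι` normalises `E`. (toy bookkeeping; no claim about print) [cite: MochizukiEtTh2009, Prop 2.2 (i) p.37] -/
theorem iota_conj_mem_kumE {e : kumPiC l} (he : e ∈ kumE l) : iota l * e * (iota l)⁻¹ ∈ kumE l := by
  have h : iota l * e * (iota l)⁻¹ = e⁻¹ := mul_eq_one_iff_eq_inv.mp (iota_conj_mul_self l he)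
  rw [h]
  exact (kumE l).inv_mem he

/-- `Π_C̲-part` normalises `D_x`. (toy bookkeeping; no claim about print) [cite: MochizukiEtTh2009, Cor 2.9 p.43] -/
theorem conj_mem_kumDx {h d : kumPiC l} (hh : h ∈ kumHp l) (hd : d ∈ kumDx l) : h * d * h⁻¹ ∈ kumDx l := by
  obtain ⟨hd1, hd2⟩ := hd
  rcases hh with hh | hh
  · exact ⟨by simp [hh, hd1], by simp [hh, hd1, hd2]⟩
  · exact ⟨by simp [hh, hd1], by simp [hh, hd1, hd2]⟩

/-- Conversely: conjugating `g = (0, 0, 1) ⋊ 1 ∈ D_x` into `D_x` forces the `D_l`-part into `{1, s r}` (the `x`-coordinate of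
`h g h⁻¹` is `a(h) = −i` resp. `i − 1`). (toy bookkeeping; no claim about print) [cite: MochizukiEtTh2009, Cor 2.9 p.43] -/
theorem mem_kumHp_of_conj_gen_mem {h : kumPiC l} (hc : h * mk l 0 0 1 1 * h⁻¹ ∈ kumDx l) : h ∈ kumHp l := by
  have hx := hc.2
  rcases hr : h.right with i | i
  · simp only [ξ_mul, ξ_inv, ζ_inv, hr, eps_r, aPar_r, DihedralGroup.inv_r, ξ_mk, ζ_mk, mk_right,
      SemidirectProduct.mul_right, mul_one, neg_neg] at hx
    have hi : i = 0 := by linear_combination -hx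
    left
    rw [hr, hi, DihedralGroup.one_def]
  · simp only [ξ_mul, ξ_inv, ζ_inv, hr, eps_sr, aPar_sr, DihedralGroup.inv_sr, ξ_mk, ζ_mk, mk_right,
      SemidirectProduct.mul_right, mul_one] at hx
    have hi : i = 1 := by linear_combination hx
    right
    rw [hr, hi]

/-- `(0, 0, 1) ⋊ 1 ∈ D_x`. (toy bookkeeping; no claim about print) [cite: MochizukiEtTh2009, Cor 2.9 p.43] -/
theorem gen_mem_kumDx : mk l 0 0 1 1 ∈ kumDx l := ⟨rfl, rfl⟩

/-- **`N(D_x) = Π_C̲-part`** in the toy. (toy bookkeeping; no claim about print) [cite: MochizukiEtTh2009, Cor 2.9 p.43] -/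
theorem normalizer_kumDx : Subgroup.normalizer ((kumDx l : Subgroup (kumPiC l)) : Set (kumPiC l)) = kumHp l := by
  refine le_antisymm (fun h hh => ?_) fun h hh => ?_
  · exact mem_kumHp_of_conj_gen_mem l ((Subgroup.mem_normalizer_iff.mp hh _).mp (gen_mem_kumDx l))
  · rw [Subgroup.mem_normalizer_iff]
    intro d
    constructor
    · exact fun hd => conj_mem_kumDx l hh hd
    · intro hd
      have h' := conj_mem_kumDx l ((kumHp l).inv_mem hh) hd
      have e : h⁻¹ * (h * d * h⁻¹) * h⁻¹⁻¹ = d := by group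
      rwa [e] at h'

/-- In `D_l` (`l` odd): `d (s r) d⁻¹ ∈ {1, s r}` forces `d ∈ {1, s r}`. (toy bookkeeping; no claim about print)
[cite: MochizukiEtTh2009, Cor 2.9 p.43] -/
theorem dihedral_conj_sr_one (hl : Odd l) {d : DihedralGroup l}
    (h : d * DihedralGroup.sr 1 * d⁻¹ = 1 ∨ d * DihedralGroup.sr 1 * d⁻¹ = DihedralGroup.sr 1) :
    d = 1 ∨ d = DihedralGroup.sr 1 := by
  have h2 : IsUnit (2 : ZMod l) := by
    have := (ZMod.isUnit_iff_coprime 2 l).mpr (Nat.coprime_two_left.mpr hl)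
    exact_mod_cast this
  rcases d with i | i
  · rcases h with h | h
    · rw [DihedralGroup.inv_r, DihedralGroup.r_mul_sr, DihedralGroup.sr_mul_r, DihedralGroup.one_def] at h
      cases h
    · rw [DihedralGroup.inv_r, DihedralGroup.r_mul_sr, DihedralGroup.sr_mul_r, DihedralGroup.sr.injEq] at h
      left
      rw [DihedralGroup.one_def, DihedralGroup.r.injEq]
      have h' : (2 : ZMod l) * i = 0 := by linear_combination -h
      exact (h2.mul_right_eq_zero).mp h'
  · rcases h with h | h
    · rw [DihedralGroup.inv_sr, DihedralGroup.sr_mul_sr, DihedralGroup.r_mul_sr, DihedralGroup.one_def] at h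
      cases h
    · rw [DihedralGroup.inv_sr, DihedralGroup.sr_mul_sr, DihedralGroup.r_mul_sr, DihedralGroup.sr.injEq] at h
      right
      rw [DihedralGroup.sr.injEq]
      have h' : (2 : ZMod l) * (i - 1) = 0 := by linear_combination h
      have := (h2.mul_right_eq_zero).mp h'
      linear_combination this

/-- Normalising `Π_C̲-part` forces the `D_l`-part into `{1, s r}` (conjugate `ι`). (toy bookkeeping; no claim about print)
[cite: MochizukiEtTh2009, Cor 2.9 p.43] -/
theorem mem_kumHp_of_conj_iota_mem (hl : Odd l) {h : kumPiC l} (hc : h * iota l * h⁻¹ ∈ kumHp l) : h ∈ kumHp l := by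
  have hc' : (h * iota l * h⁻¹).right = 1 ∨ (h * iota l * h⁻¹).right = DihedralGroup.sr 1 := hc
  rw [SemidirectProduct.mul_right, SemidirectProduct.mul_right, SemidirectProduct.inv_right, iota_right] at hc'
  exact dihedral_conj_sr_one l hl hc'

/-- **Commutators of `Δ_X` fill the centre**: `(0, y, 0) ⋊ 1 = [r, (h y, 0, 0) ⋊ 1]` whenever `2 h = 1` (`l` odd). (toy
bookkeeping; no claim about print) [cite: MochizukiEtTh2009, Def 2.1 p.36] -/
theorem mk_y_eq_commutator (hh : ∃ h : ZMod l, 2 * h = 1) (y : ZMod l) :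
    ∃ b : kumPiC l, b ∈ kumPiX l ⊓ (aug l).ker ∧
      mk l 0 y 0 1 = SemidirectProduct.inr (DihedralGroup.r 1) * b * (SemidirectProduct.inr (DihedralGroup.r 1))⁻¹ * b⁻¹ := by
  obtain ⟨h, h2⟩ := hh
  refine ⟨mk l (h * y) 0 0 1, ⟨(mem_kumPiX l).mpr ⟨0, by rw [mk_right, DihedralGroup.one_def]⟩, (mem_ker_aug l).mpr rfl⟩,
    ext_of_coords l ?_ ?_ ?_ ?_⟩
  · simp [mk]
  · simp [mk]
  · simp only [υ_mk, υ_mul, υ_inv, ξ_inv, ζ_inv, SemidirectProduct.mul_right, SemidirectProduct.inv_right,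
      SemidirectProduct.right_inr, mk_right, υ_inr, ξ_inr, ζ_inr, ξ_mk, υ_mk, ζ_mk, mul_one, DihedralGroup.inv_r,
      DihedralGroup.r_mul_r, rotIdx_r, eps_r, aPar_r, qPar, inv_one, rotIdx_one]
    linear_combination (-y) * h2
  · simp

/-- `r ∈ Δ_X`. (toy bookkeeping; no claim about print) [cite: MochizukiEtTh2009, Def 2.1 p.36] -/
theorem inr_r_mem_delta (i : ZMod l) : (SemidirectProduct.inr (DihedralGroup.r i) : kumPiC l) ∈ kumPiX l ⊓ (aug l).ker :=
  ⟨(mem_kumPiX l).mpr ⟨i, rfl⟩, (mem_ker_aug l).mpr (ζ_inr l _)⟩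

/-- Commutators of `Δ_X` lie in the centre. (toy bookkeeping; no claim about print) [cite: MochizukiEtTh2009, Def 2.1 p.36] -/
theorem commutator_mem_kumZ {a b : kumPiC l} (ha : a ∈ kumPiX l ⊓ (aug l).ker) (hb : b ∈ kumPiX l ⊓ (aug l).ker) :
    a * b * a⁻¹ * b⁻¹ ∈ kumZ l := by
  obtain ⟨⟨i, hi⟩, hza⟩ := (mem_delta_iff l).mp ha
  obtain ⟨⟨j, hj⟩, hzb⟩ := (mem_delta_iff l).mp hb
  refine ⟨?_, ?_, ?_⟩
  · rw [SemidirectProduct.mul_right, SemidirectProduct.mul_right, SemidirectProduct.mul_right,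
      SemidirectProduct.inv_right, SemidirectProduct.inv_right, hi, hj, DihedralGroup.inv_r, DihedralGroup.inv_r,
      DihedralGroup.r_mul_r, DihedralGroup.r_mul_r, DihedralGroup.r_mul_r, DihedralGroup.one_def]
    exact congrArg DihedralGroup.r (by ring)
  · simp [hi, hj, hza, hzb]
  · simp [hza, hzb]

/-- `⁅Δ_X, Δ_X⁆ ⊆` centre. (toy bookkeeping; no claim about print) [cite: MochizukiEtTh2009, Def 2.1 p.36] -/
theorem commutator_delta_le_kumZ : ⁅kumPiX l ⊓ (aug l).ker, kumPiX l ⊓ (aug l).ker⁆ ≤ kumZ l := by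
  rw [Subgroup.commutator_le]
  intro a ha b hb
  exact commutator_mem_kumZ l ha hb

/-! ## 8. The centre as the image of `ℤ/l` -/

/-- The embedding `y ↦ (0, y, 0) ⋊ 1` of `ℤ/l` onto the centre. (toy bookkeeping; no claim about print) [cite: MochizukiEtTh2009, Def 2.1 p.36] -/
def zEmb : Multiplicative (ZMod l) →* kumPiC l where
  toFun t := mk l 0 (toAdd t) 0 1
  map_one' := rfl
  map_mul' a b := ext_of_coords l (by simp [mk]) (by simp) (by simp [toAdd_mul]) (by simp)

/-- The centre is the image of `zEmb`. (toy bookkeeping; no claim about print) [cite: MochizukiEtTh2009, Def 2.1 p.36] -/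
theorem kumZ_eq_range : kumZ l = (zEmb l).range := by
  ext g
  constructor
  · intro hg
    exact ⟨ofAdd (υ l g), by rw [eq_mk_of_mem_kumZ l hg]; rfl⟩
  · rintro ⟨t, rfl⟩
    exact ⟨rfl, rfl, rfl⟩

/-- `zEmb` is injective. (toy bookkeeping; no claim about print) [cite: MochizukiEtTh2009, Def 2.1 p.36] -/
theorem zEmb_injective : Function.Injective (zEmb l) := by
  intro a b h
  have := congrArg (υ l) h
  simpa [zEmb] using this

/-- `|Δ̄_Θ-part| = l`. (toy bookkeeping; no claim about print) [cite: MochizukiEtTh2009, Def 2.1 p.36] -/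
theorem card_kumZ : Nat.card (kumZ l) = l := by
  rw [kumZ_eq_range, ← Nat.card_congr (MonoidHom.ofInjective (zEmb_injective l)).toEquiv,
    Nat.card_congr (Multiplicative.toAdd : Multiplicative (ZMod l) ≃ ZMod l), Nat.card_zmod]

end KummerWitness

end ThetaCovers

end Literature.AnabelianGeometry.EtaleTheta
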